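import Mathlib
import HarnessLib
import Literature.Analysis.FluidPDE.SuitableWeak

/-!
# Route `AxisTwistDoor`, crux `AveragedConeLiouville` (stmt-NavierStokesRegularity-26889) — toward replacing the
# Lei–Ren input (programme R2), piece S3: A SHELL AVOIDING A COMPACT `𝒫¹`-NULL SET

Programme R2 (LEAD census CENSUS-26889-g2.md) finds the regular shell `{a−δ < |x_h| < a+δ}` of a limit profile by
partial regularity: the singular set (interior, `ckn_partial_regularity_holds`; lid, piece S2 `…LidTheoremB`) is a
COMPACT set of one-dimensional parabolic Hausdorff measure zero, and this file shows that such a set leaves free a whole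
interval of values of any `1`-Lipschitz function of the space variable — applied to the distance to the vertical axis
it leaves a closed cylindrical shell free of singular points:

* `exists_gap_of_isParabolicNull` — if `S ⊆ ℝ × ℝ³` is compact with `𝒫¹(S) = 0`, `φ : ℝ³ → ℝ` is `1`-Lipschitz and
  `α < β`, then there are `a` and `η > 0` with `α < a − η < a + η < β` such that `φ(x) ∉ [a − η, a + η]` for every
  `(t, x) ∈ S`.  Proof: a cover of `S` by centred cylinders `Q*_{ρᵢ}(zᵢ)` with `∑ ρᵢ < (β − α)/4` (content `0`) has a
  finite subcover (compactness); the values `φ(x)`, `(t,x) ∈ S`, lie in the finitely many closed intervals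
  `[φ(xᵢ) − ρᵢ, φ(xᵢ) + ρᵢ]`, of total length `< (β − α)/2`, so their complement in `(α, β)` is a non-empty open set.

Pure measure theory / topology; no Navier–Stokes content.  Seat ns-atd-p1 (LEAD g2).  WHAT THIS IS NOT: not a
statement about Navier–Stokes regularity.  Lands `--supports` the crux item as a helper.
-/

noncomputable section

set_option linter.dupNamespace false

namespace Summit.NavierStokesRegularity.NavierStokesRegularity.Theorems.AveragedConeLiouville.RadialGap

open scoped ENNReal NNReal Topology
open Set Function MeasureTheory Metric Filter
open Literature.Analysis.FluidPDE

/-- From `𝒫¹(S) = 0`: for every `η > 0` a countable cover of `S` by centred parabolic cylinders with radii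
`0 ≤ ρᵢ < 1` and `∑ ρᵢ < η`. -/
theorem exists_cover_of_isParabolicNull {S : Set (ℝ × EuclideanSpace ℝ (Fin 3))} (hS : IsParabolicNull 1 S)
    {η : ℝ} (hη : 0 < η) :
    ∃ (z : ℕ → ℝ × EuclideanSpace ℝ (Fin 3)) (ρ : ℕ → ℝ), (∀ i, 0 ≤ ρ i ∧ ρ i < 1) ∧
      S ⊆ ⋃ i, parabolicCylinderCentered (ρ i) (z i) ∧ ∑' i, ENNReal.ofReal (ρ i) < ENNReal.ofReal η := by
  have h1 : parabolicHausdorffContent 1 1 S = 0 := by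
    have h := hS
    unfold IsParabolicNull parabolicHausdorff at h
    exact le_antisymm
      ((le_iSup₂ (f := fun δ (_ : (0 : ℝ) < δ) => parabolicHausdorffContent 1 δ S) 1 one_pos).trans h.le)
      bot_le
  have h2 : parabolicHausdorffContent 1 1 S < ENNReal.ofReal η := by
    rw [h1]; exact ENNReal.ofReal_pos.2 hη
  unfold parabolicHausdorffContent at h2
  simp only [iInf_lt_iff, Real.rpow_one] at h2
  obtain ⟨z, ρ, hρ, hcov, hsum⟩ := h2
  exact ⟨z, ρ, hρ, hcov, hsum⟩

/-- **A compact `𝒫¹`-null set leaves a gap in the values of any `1`-Lipschitz function of the space variable.** -/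
theorem exists_gap_of_isParabolicNull {S : Set (ℝ × EuclideanSpace ℝ (Fin 3))} (hSc : IsCompact S)
    (hS : IsParabolicNull 1 S) {φ : EuclideanSpace ℝ (Fin 3) → ℝ} (hφ : LipschitzWith 1 φ) {α β : ℝ}
    (hαβ : α < β) :
    ∃ a η : ℝ, 0 < η ∧ α < a - η ∧ a + η < β ∧ ∀ w ∈ S, φ w.2 < a - η ∨ a + η < φ w.2 := by
  -- a countable cover with small radii, then a finite subcover
  obtain ⟨z, ρ, hρ, hcov, hsum⟩ := exists_cover_of_isParabolicNull hS (by linarith : 0 < (β - α) / 4)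
  obtain ⟨J, hJ⟩ := hSc.elim_finite_subcover (fun i => parabolicCylinderCentered (ρ i) (z i))
    (fun i => isOpen_parabolicCylinderCentered _ _) hcov
  -- the closed value-intervals `[φ(xᵢ) − ρᵢ, φ(xᵢ) + ρᵢ]`, `i ∈ J`
  set I : ℕ → Set ℝ := fun i => Icc (φ (z i).2 - ρ i) (φ (z i).2 + ρ i) with hI
  have hval : ∀ w ∈ S, ∃ i ∈ J, φ w.2 ∈ I i := by
    intro w hw
    obtain ⟨i, hi, hwi⟩ := mem_iUnion₂.1 (hJ hw)
    refine ⟨i, hi, ?_⟩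
    rw [mem_parabolicCylinderCentered] at hwi
    have hd : dist (φ w.2) (φ (z i).2) ≤ dist w.2 (z i).2 := by
      have := hφ.dist_le_mul w.2 (z i).2
      simpa using this
    rw [Real.dist_eq] at hd
    have hlt : dist w.2 (z i).2 < ρ i := hwi.2
    rw [hI]; constructor <;> [linarith [(abs_le.1 (hd.trans hlt.le)).1]; linarith [(abs_le.1 (hd.trans hlt.le)).2]]
  -- their total length is `< (β − α)/2`
  have hlen : volume (⋃ i ∈ J, I i) < ENNReal.ofReal (β - α) := by
    calc volume (⋃ i ∈ J, I i) ≤ ∑ i ∈ J, volume (I i) := measure_biUnion_finset_le J I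
      _ = ∑ i ∈ J, ENNReal.ofReal (2 * ρ i) := by
          refine Finset.sum_congr rfl fun i _ => ?_
          rw [hI, Real.volume_Icc]
          congr 1; ring
      _ = 2 * ∑ i ∈ J, ENNReal.ofReal (ρ i) := by
          rw [Finset.mul_sum]
          refine Finset.sum_congr rfl fun i _ => ?_
          rw [ENNReal.ofReal_mul (by norm_num), ENNReal.ofReal_ofNat]
      _ ≤ 2 * ∑' i, ENNReal.ofReal (ρ i) := mul_le_mul' le_rfl (ENNReal.sum_le_tsum J)
      _ ≤ 2 * ENNReal.ofReal ((β - α) / 4) := mul_le_mul' le_rfl hsum.le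
      _ = ENNReal.ofReal ((β - α) / 2) := by
          rw [← ENNReal.ofReal_ofNat, ← ENNReal.ofReal_mul (by norm_num)]
          congr 1; ring
      _ < ENNReal.ofReal (β - α) := (ENNReal.ofReal_lt_ofReal_iff (by linarith)).2 (by linarith)
  -- so the open set `U = (α, β) ∖ ⋃ Iᵢ` is non-empty
  set U : Set ℝ := Ioo α β \ ⋃ i ∈ J, I i with hU
  have hUo : IsOpen U := isOpen_Ioo.sdiff (isClosed_biUnion_finset fun i _ => isClosed_Icc)
  have hUne : U.Nonempty := by
    by_contra hemp
    rw [not_nonempty_iff_eq_empty] at hemp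
    have hsub : Ioo α β ⊆ ⋃ i ∈ J, I i := sdiff_eq_empty.1 hemp
    have h1 : volume (Ioo α β) ≤ volume (⋃ i ∈ J, I i) := measure_mono hsub
    rw [Real.volume_Ioo] at h1
    exact absurd (h1.trans_lt hlen) (lt_irrefl _)
  obtain ⟨a, haU⟩ := hUne
  obtain ⟨η₀, hη₀, hball⟩ := Metric.isOpen_iff.1 hUo a haU
  -- the gap `[a − η, a + η]`, `η = η₀/2`
  refine ⟨a, η₀ / 2, by positivity, ?_, ?_, fun w hw => ?_⟩
  · have : a - η₀ / 2 ∈ U := hball (by rw [mem_ball, Real.dist_eq, abs_of_nonpos (by linarith)]; linarith)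
    have := this.1.1; linarith
  · have : a + η₀ / 2 ∈ U := hball (by rw [mem_ball, Real.dist_eq, abs_of_nonneg (by linarith)]; linarith)
    have := this.1.2; linarith
  · obtain ⟨i, hi, hwi⟩ := hval w hw
    by_contra hcon
    push Not at hcon
    -- `φ(x) ∈ [a − η, a + η] ⊆ ball a η₀ ⊆ U`, but `φ(x) ∈ Iᵢ` is excluded from `U`
    have hmem : φ w.2 ∈ U := hball (by
      rw [mem_ball, Real.dist_eq, abs_lt]; constructor <;> linarith [hcon.1, hcon.2])
    exact hmem.2 (mem_biUnion hi hwi)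

end Summit.NavierStokesRegularity.NavierStokesRegularity.Theorems.AveragedConeLiouville.RadialGap

end
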